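import Summits.Ventures.CertifiedQuantumChemistry.Rows.DifferenceRows
import Summits.Ventures.CertifiedQuantumChemistry.Rows.SingletFromSectorGap
import Summits.Ventures.CertifiedQuantumChemistry.Rows.SpinOneGroundState
import HarnessLib

/-!
# Ventures/CertifiedQuantumChemistry — Rows/SpinLadderDifferenceRows.lean: same-file, same-`N`, two-sector
# ("spin-ladder") difference rows — the free sign, the one-`L`-one-`U` bracket, and what a certified
# POSITIVE gap decides

HONEST FRAMING (verbatim): certified bounds for a stated model Hamiltonian in a stated basis; not a
claim about the real molecule or material beyond that model.

LADDER-CHEM I-TYPE (cell chem-oracle, seat chem-type-06, 2026-08-26; zero compute; PROVED glue only —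
0 sorry, no `def`, no claim node; nothing in this file asserts a bound about any pinned file). The cell's
difference-row key admits two SECTORS of ONE file, `dE@fcidump:<sha8>:Na<a>:Nb<b>-<sha8>:Na<a'>:Nb<b'>`
(START-HERE §3.1; the pinned pairs `fe4s4-spinladder` `(28,26)|(27,27)`, the `M_S = 0` vs `2` pair CO2.D,
every singlet–triplet / singlet–quintet question): the quantity is
`Model.energyDiff F a b F a' b' = E(a, b) − E(a', b')` with `E(a, b) := Model.energy F a b = E₀(H_F; N_α = a,
N_β = b)` and the row predicates are chem-type-01's `DiffLowerRow` / `DiffUpperRow` / `DiffBracket`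
(`Rows/DifferenceRows.lean`). For such pairs with EQUAL electron number `a + b = a' + b'` the tree already
PROVES more than interval subtraction gives, and this file writes it in the row language:

* §1 THE FREE SIGN. The spin-free Hamiltonian is a singlet operator, `[Ŝ², Ĥ] = 0`, `[Ŝ_z, Ĥ] = 0`
  (Helgaker–Jørgensen–Olsen (2000) §2.4.1 eqs. (2.4.2)–(2.4.3), p. 47; §2.3.1 p. 42: a singlet operator
  commutes with `Ŝ_±`), so the `S_z = M` sector hosts every spin multiplet with `S ≥ |M|` and the sector
  energies are non-decreasing in `|N_α − N_β|` at fixed `N` — the tree's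
  `Model.energy_le_energy_of_max_le` (`Rows/SpinSectors.lean`; mechanism Lieb–Mattis, J. Math. Phys. 3
  (1962) 749 §I; Lieb, PRL 62 (1989) 1201, proof of Thm 1; Tasaki (1998) Def. 2.1 for `E_min(S)`).
  In row form: `DiffLowerRow F a b F a' b' 0` whenever `max a' b' ≤ max a b` (`diffLowerRow_zero_of_max_le`),
  with the one-flip shape `(a + 1, b) | (a, b + 1)`, `b ≤ a` (`diffLowerRow_zero_step`) and the
  `(n + 1, n − 1) | (n, n)` shape of the singlet files (`diffLowerRow_zero_succ_pred`).
* §2 THE ONE-`L`-ONE-`U` BRACKET. Hence ONE upper row in the high-`|M|` sector and ONE lower row in the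
  low-`|M|` sector already bracket the difference, `DiffBracket F a b F a' b' 0 (hi − lo)`
  (`diffBracket_zero_of_upperRow_lowerRow`), and two absolute brackets give the CLIPPED from-absolutes
  bracket `[max 0 (L_A − U_B), U_A − L_B]` (`diffBracket_clip_of_brackets`). HONESTY LEMMA
  (`not_diffWidthBeatsAbsolutes_zero_of_ordered`): when the absolute slots are ordered like the energies
  (`U_B ≤ U_A`, `L_B ≤ L_A`) the clipped bracket NEVER passes the I-DIFF STEP-0 test
  `W(ΔE) < ½ (W_A + W_B)` — the free sign is row hygiene (never table a negative lower slot for a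
  provably non-negative quantity), not a difference-certificate class.
* §3 WHAT A CERTIFIED POSITIVE GAP DECIDES. A difference lower row with a POSITIVE slot on the
  `(n + 1, n − 1) | (n, n)` pair — of any provenance: clipped absolutes with `L_A > U_B`, or a direct
  sector-difference certificate — proves `E(n, n) < E(n + 1, n − 1)`, hence (tree lemmas of
  `Rows/SingletVersusSector.lean` / `Rows/SingletFromSectorGap.lean`, instantiated):
  `E(n, n) = E₀(H_F; 2n, S = 0)` (`DiffLowerRow.energy_eq_singletEnergy_of_pos`: the model's `2n`-electron
  `S_z = 0` ground states are singlets), the sector `U` is a singlet `U`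
  (`DiffLowerRow.singletUpperRow_of_pos`), a singlet-restricted `L` (key `e0S0[…]`) is a SECTOR `L`
  (`DiffLowerRow.lowerRow_of_singletLowerRow_of_pos`), and `Ŝ_+` annihilates every `(n, n)` ground
  vector (`DiffLowerRow.spinPlus_mulVec_eq_zero_of_pos`); at any rung `(a + 1, b) | (a, b + 1)` a positive
  slot makes the `(a, b + 1)` ground vectors highest-weight vectors, `Ŝ_+ χ = 0`, i.e. of total spin
  exactly `|S_z|` (`DiffLowerRow.spinPlus_mulVec_eq_zero_of_pos_step`, via `Rows/SpinOneGroundState.lean`).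

WHAT THIS IS NOT: not a difference-certificate class (no certificate format, reader or kernel is
introduced); never an I-DIFF STEP-0 pass by itself (§2); says NOTHING about which spin multiplet is the
ground state unless a POSITIVE lower slot is certified (§3; `0 ≤ ΔE` holds for every symmetric model),
and a HIGH-spin ground state (degenerate consecutive sectors, no gap) is only ever bracketed, never decided;
pairs that change the electron number (redox / attachment) get no free sign here; nothing about any real
molecule.
-/

noncomputable section

namespace Summit.Ventures.CertifiedQuantumChemistry

open Matrix Finset
open Literature.MathematicalPhysics.QuantumLattice Literature.MathematicalPhysics.QuantumChemistry

variable {k : ℕ}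

/-! ## §1 The free sign: `0 ≤ E(a, b) − E(a', b')` for `a + b = a' + b'`, `|a' − b'| ≤ |a − b|` -/

/-- **THE FREE SIGN of a same-file, same-`N` sector difference.** For a symmetric model `F`, a realised
sector `(a, b)` (`a, b ≤ k`) and any `(a', b')` with `a' + b' = a + b` and `max a' b' ≤ max a b`
(equivalently `|a' − b'| ≤ |a − b|`): `DiffLowerRow F a b F a' b' 0`, i.e.
`0 ≤ E₀(H_F; a, b) − E₀(H_F; a', b')` — the `S_z` sector of larger `|M|` hosts fewer spin multiplets of the
singlet operator `Ĥ` ("`[Ŝ², Ĥ] = 0`, `[Ŝ_z, Ĥ] = 0`", HJO (2.4.2)–(2.4.3)). One-line instance of the tree's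
`Model.energy_le_energy_of_max_le` (`Rows/SpinSectors.lean`).
[cite: HelgakerJorgensenOlsen2000, §2.4.1 eqs. (2.4.2)-(2.4.3), p. 47] -/
theorem diffLowerRow_zero_of_max_le {F : Model k} (hF : F.IsSymmetric) {a b a' b' : ℕ} (ha : a ≤ k)
    (hb : b ≤ k) (hsum : a' + b' = a + b) (hmax : max a' b' ≤ max a b) :
    DiffLowerRow F a b F a' b' 0 := by
  have hk : max a' b' ≤ k := hmax.trans (max_le ha hb)
  refine ⟨⟨ha, hb⟩, ⟨(le_max_left _ _).trans hk, (le_max_right _ _).trans hk⟩, ?_⟩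
  have h := Model.energy_le_energy_of_max_le hF ha hb hsum hmax
  push_cast
  linarith

/-- The same sign as a difference UPPER row of the swapped pair: `E₀(H_F; a', b') − E₀(H_F; a, b) ≤ 0`
(`a' + b' = a + b`, `max a' b' ≤ max a b`, `a, b ≤ k`). [cite: HelgakerJorgensenOlsen2000, §2.4.1
eqs. (2.4.2)-(2.4.3), p. 47] -/
theorem diffUpperRow_zero_of_max_le {F : Model k} (hF : F.IsSymmetric) {a b a' b' : ℕ} (ha : a ≤ k)
    (hb : b ≤ k) (hsum : a' + b' = a + b) (hmax : max a' b' ≤ max a b) :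
    DiffUpperRow F a' b' F a b 0 := by
  have h := (diffLowerRow_iff_diffUpperRow_swap F a b F a' b' 0).1
    (diffLowerRow_zero_of_max_le hF ha hb hsum hmax)
  simpa using h

/-- **One spin flip** (the shape of the pinned spin-ladder pairs, e.g. `(28, 26) | (27, 27)`): for
`b ≤ a` and `a + 1 ≤ k`, `DiffLowerRow F (a + 1) b F a (b + 1) 0`, i.e.
`0 ≤ E₀(H_F; a + 1, b) − E₀(H_F; a, b + 1)`. [cite: HelgakerJorgensenOlsen2000, §2.4.1
eqs. (2.4.2)-(2.4.3), p. 47] -/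
theorem diffLowerRow_zero_step {F : Model k} (hF : F.IsSymmetric) {a b : ℕ} (hba : b ≤ a)
    (ha : a + 1 ≤ k) : DiffLowerRow F (a + 1) b F a (b + 1) 0 :=
  diffLowerRow_zero_of_max_le hF ha (by omega) (by omega) (by omega)

/-- **The `(n + 1, n − 1) | (n, n)` shape** of the tree's singlet files (`Rows/SingletVersusSector.lean`
`Model.energy_le_energy_succ_pred`): for `1 ≤ n`, `n + 1 ≤ k`, `DiffLowerRow F (n + 1) (n - 1) F n n 0`,
i.e. `0 ≤ E₀(H_F; n + 1, n − 1) − E₀(H_F; n, n)`. [cite: HelgakerJorgensenOlsen2000, §2.4.1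
eqs. (2.4.2)-(2.4.3), p. 47] -/
theorem diffLowerRow_zero_succ_pred {F : Model k} (hF : F.IsSymmetric) {n : ℕ} (hn1 : 1 ≤ n)
    (hn : n + 1 ≤ k) : DiffLowerRow F (n + 1) (n - 1) F n n 0 :=
  diffLowerRow_zero_of_max_le hF hn (by omega) (by omega) (by omega)

/-! ## §2 The one-`L`-one-`U` bracket and the clipped `dE-from-absolutes` bracket -/

/-- **ONE `U` AND ONE `L` BRACKET A SPIN-LADDER DIFFERENCE.** For a symmetric model, an UPPER row `hi`
in the sector `(a, b)` and a LOWER row `lo` in a sector `(a', b')` of the same electron number with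
`max a' b' ≤ max a b` give `DiffBracket F a b F a' b' 0 (hi − lo)`:
`0 ≤ E₀(H_F; a, b) − E₀(H_F; a', b') ≤ U − L` (§1 for the lower slot; ORACLE-SPEC §1.3 (i) interval
subtraction `diffUpperRow_of_upperRow_lowerRow` for the upper slot). [cite: HelgakerJorgensenOlsen2000,
§2.4.1 eqs. (2.4.2)-(2.4.3), p. 47] -/
theorem diffBracket_zero_of_upperRow_lowerRow {F : Model k} (hF : F.IsSymmetric) {a b a' b' : ℕ}
    {hi lo : ℚ} (hU : UpperRow F a b hi) (hL : LowerRow F a' b' lo) (hsum : a' + b' = a + b)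
    (hmax : max a' b' ≤ max a b) : DiffBracket F a b F a' b' 0 (hi - lo) :=
  ⟨diffLowerRow_zero_of_max_le hF hU.range.1 hU.range.2 hsum hmax,
    diffUpperRow_of_upperRow_lowerRow hU hL⟩

/-- **THE CLIPPED `dE-from-absolutes` BRACKET.** Two absolute brackets `[L_A, U_A] ∋ E₀(H_F; a, b)`,
`[L_B, U_B] ∋ E₀(H_F; a', b')` on a same-`N` pair with `max a' b' ≤ max a b` give
`DiffBracket F a b F a' b' (max 0 (L_A − U_B)) (U_A − L_B)`: the interval-subtraction bracket of
`diffBracket_of_brackets` with its lower slot clipped at the free sign `0`.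
[cite: HelgakerJorgensenOlsen2000, §2.4.1 eqs. (2.4.2)-(2.4.3), p. 47] -/
theorem diffBracket_clip_of_brackets {F : Model k} (hF : F.IsSymmetric) {a b a' b' : ℕ}
    {loA hiA loB hiB : ℚ} (hA : Bracket F a b loA hiA) (hB : Bracket F a' b' loB hiB)
    (hsum : a' + b' = a + b) (hmax : max a' b' ≤ max a b) :
    DiffBracket F a b F a' b' (max 0 (loA - hiB)) (hiA - loB) := by
  have h0 := diffLowerRow_zero_of_max_le hF hA.2.range.1 hA.2.range.2 hsum hmax
  have h1 := diffBracket_of_brackets hA hB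
  refine ⟨⟨h1.1.1, h1.1.2.1, ?_⟩, h1.2⟩
  have e0 := h0.2.2
  have e1 := h1.1.2.2
  push_cast at e0 e1 ⊢
  exact max_le e0 e1

/-- **HONESTY LEMMA: the free sign is never an I-DIFF STEP-0 pass.** If the absolute slots are ordered
like the energies (`U_B ≤ U_A` and `L_B ≤ L_A` — the generic situation for a high-`|M|` sector `A` above
a low-`|M|` sector `B` certified at comparable widths), the clipped bracket `[0, U_A − L_B]` does NOT beat
half the sum of the absolute widths (`DiffWidthBeatsAbsolutes` of `Rows/DifferenceRows.lean`): its width is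
`U_A − L_B = ½ (W_A + W_B) + ½ ((U_A − U_B) + (L_A − L_B)) ≥ ½ (W_A + W_B)`. A statement about four
rationals; no energy involved. (In-house: the STEP-0 test of LADDER-CHEM §1 row I-DIFF / ORACLE-SPEC
§1.3, predicate `DiffWidthBeatsAbsolutes`.) -/
theorem not_diffWidthBeatsAbsolutes_zero_of_ordered {loA hiA loB hiB : ℚ} (hU : hiB ≤ hiA)
    (hL : loB ≤ loA) : ¬ DiffWidthBeatsAbsolutes 0 (hiA - loB) loA hiA loB hiB := by
  unfold DiffWidthBeatsAbsolutes
  intro h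
  linarith

/-! ## §3 What a certified POSITIVE spin gap decides -/

/-- A difference lower row with a POSITIVE slot is a STRICT inequality between the two sector energies:
`DiffLowerRow F a b F a' b' lo`, `0 < lo` ⟹ `E₀(H_F; a', b') < E₀(H_F; a, b)` (any provenance of the row:
clipped absolutes with `L_A > U_B`, or a direct sector-difference certificate; in-house reading of the
`ΔE_L` slot of ORACLE-SPEC §1.3). -/
theorem DiffLowerRow.energy_lt_of_pos {F : Model k} {a b a' b' : ℕ} {lo : ℚ}
    (h : DiffLowerRow F a b F a' b' lo) (hlo : 0 < lo) : F.energy a' b' < F.energy a b := by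
  have h1 := h.le
  have h2 : (0 : ℝ) < ((lo : ℚ) : ℝ) := by exact_mod_cast hlo
  unfold Model.energyDiff at h1
  linarith

/-- **A CERTIFIED POSITIVE `(n + 1, n − 1) | (n, n)` GAP CERTIFIES A SINGLET GROUND STATE of the model in
`S_z = 0`.** For a symmetric model and `1 ≤ n`: `DiffLowerRow F (n + 1) (n - 1) F n n lo` with `0 < lo`
proves `E₀(H_F; n, n) = E₀(H_F; 2n, S = 0)` (`Model.singletEnergy`) and
`E₀(H_F; 2n, S = 0) < E₀(H_F; n + 1, n − 1)` — the tree's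
`Model.energy_eq_min_singletEnergy_energy` (`E(n, n) = min (E₀(2n, S = 0), E(n + 1, n − 1))`,
`Rows/SingletVersusSector.lean`) with the second branch excluded by the strict gap. (Tasaki (1998)
Def. 2.1: `E_min(S)` = the lowest energy among states with `(Ŝ_tot)² Φ = S(S + 1) Φ`.)
[cite: HelgakerJorgensenOlsen2000, §2.4.1 eqs. (2.4.2)-(2.4.3), p. 47] -/
theorem DiffLowerRow.energy_eq_singletEnergy_of_pos {F : Model k} (hF : F.IsSymmetric) {n : ℕ}
    {lo : ℚ} (h : DiffLowerRow F (n + 1) (n - 1) F n n lo) (hlo : 0 < lo) (hn1 : 1 ≤ n) :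
    F.energy n n = F.singletEnergy n ∧ F.singletEnergy n < F.energy (n + 1) (n - 1) := by
  have hlt : F.energy n n < F.energy (n + 1) (n - 1) := h.energy_lt_of_pos hlo
  have hmin := Model.energy_eq_min_singletEnergy_energy hF hn1 h.1.1
  have heq : F.energy n n = F.singletEnergy n := by
    rcases min_choice (F.singletEnergy n) (F.energy (n + 1) (n - 1)) with hc | hc
    · rw [hmin, hc]
    · rw [hmin, hc] at hlt
      exact absurd hlt (lt_irrefl _)
  exact ⟨heq, heq ▸ hlt⟩

/-- Under a certified positive `(n + 1, n − 1) | (n, n)` gap, the `(n, n)` SECTOR upper row IS a SINGLET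
upper row (`SingletUpperRow F n hi`, key `e0S0[…]` of START-HERE §3.1): no singlet-adapted trial state is
needed (the tree's `UpperRow.singletUpperRow_of_sectorGap` with the gap supplied by the difference row).
[cite: HelgakerJorgensenOlsen2000, §2.4.1 eqs. (2.4.2)-(2.4.3), p. 47] -/
theorem DiffLowerRow.singletUpperRow_of_pos {F : Model k} (hF : F.IsSymmetric) {n : ℕ} {lo hi : ℚ}
    (h : DiffLowerRow F (n + 1) (n - 1) F n n lo) (hlo : 0 < lo) (hn1 : 1 ≤ n)
    (hU : UpperRow F n n hi) : SingletUpperRow F n hi :=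
  ⟨hU.range.1, (h.energy_eq_singletEnergy_of_pos hF hlo hn1).1 ▸ hU.le⟩

/-- Under a certified positive `(n + 1, n − 1) | (n, n)` gap, a SINGLET-RESTRICTED lower row `lo₁`
(relaxation with `⟨Ŝ²⟩ = 0`, usually tighter) IS an `(n, n)` SECTOR lower row: `LowerRow F n n lo₁` (the
tree's `SingletLowerRow.lowerRow_of_sectorGap` with the gap supplied by the difference row).
[cite: HelgakerJorgensenOlsen2000, §2.4.1 eqs. (2.4.2)-(2.4.3), p. 47] -/
theorem DiffLowerRow.lowerRow_of_singletLowerRow_of_pos {F : Model k} (hF : F.IsSymmetric) {n : ℕ}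
    {lo lo₁ : ℚ} (h : DiffLowerRow F (n + 1) (n - 1) F n n lo) (hlo : 0 < lo) (hn1 : 1 ≤ n)
    (hS : SingletLowerRow F n lo₁) : LowerRow F n n lo₁ :=
  ⟨hS.range, hS.range, hS.le.trans_eq (h.energy_eq_singletEnergy_of_pos hF hlo hn1).1.symm⟩

/-- Under a certified positive `(n + 1, n − 1) | (n, n)` gap, a singlet-restricted lower row `lo₁` and the
sector upper row `hi` BRACKET the `(n, n)` sector energy: `Bracket F n n lo₁ hi` (key `e0[…]`; the tree's
`SingletLowerRow.bracket_of_sectorGap` with the gap supplied by the difference row).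
[cite: HelgakerJorgensenOlsen2000, §2.4.1 eqs. (2.4.2)-(2.4.3), p. 47] -/
theorem DiffLowerRow.bracket_of_singletLowerRow_of_pos {F : Model k} (hF : F.IsSymmetric) {n : ℕ}
    {lo lo₁ hi : ℚ} (h : DiffLowerRow F (n + 1) (n - 1) F n n lo) (hlo : 0 < lo) (hn1 : 1 ≤ n)
    (hS : SingletLowerRow F n lo₁) (hU : UpperRow F n n hi) : Bracket F n n lo₁ hi :=
  ⟨h.lowerRow_of_singletLowerRow_of_pos hF hlo hn1 hS, hU⟩

/-- **THE MODEL's `2n`-electron ground states in `S_z = 0` ARE SINGLETS**, certified by a positive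
`(n + 1, n − 1) | (n, n)` difference lower row: every eigenvector `χ` of `H_F` in the `(n, n)` sector at the
sector energy is annihilated by `Ŝ_+` (the tree's `spinPlus_mulVec_eq_zero_of_sectorGroundEnergy_lt`,
`Rows/SingletVersusSector.lean`). [cite: HelgakerJorgensenOlsen2000, §2.4.1 eqs. (2.4.2)-(2.4.3), p. 47] -/
theorem DiffLowerRow.spinPlus_mulVec_eq_zero_of_pos {F : Model k} (hF : F.IsSymmetric) {n : ℕ}
    {lo : ℚ} (h : DiffLowerRow F (n + 1) (n - 1) F n n lo) (hlo : 0 < lo)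
    {χ : Fock (Orb (Fin k))} (hχ : IsInSector n n χ)
    (hHχ : F.hamiltonian *ᵥ χ = ((F.energy n n : ℝ) : ℂ) • χ) : spinPlus *ᵥ χ = 0 :=
  spinPlus_mulVec_eq_zero_of_sectorGroundEnergy_lt (F.hamiltonian_isHermitian hF)
    (molecularHamiltonian_commute_spinPlus _ _ _) (h.energy_lt_of_pos hlo) hχ hHχ

/-- **ANY RUNG OF THE LADDER: a certified positive one-flip gap makes the lower sector's ground vectors
HIGHEST-WEIGHT vectors.** For a symmetric model, `DiffLowerRow F (a + 1) b F a (b + 1) lo` with `0 < lo`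
(`0 < lo ≤ E₀(H_F; a + 1, b) − E₀(H_F; a, b + 1)`) proves that every eigenvector `χ` of `H_F` in the
sector `(a, b + 1)` at the sector energy satisfies `Ŝ_+ χ = 0` — so for `b + 1 ≤ a` its total spin is
EXACTLY `S = (a − b − 1)/2 = |S_z|` (e.g. `(n + 2, n − 2) | (n + 1, n − 1)`: the `S_z = 1` ground states are
triplets, not quintet components). The tree's `spinPlus_mulVec_eq_zero_of_lt_of_sector`
(`Rows/SpinOneGroundState.lean`) with the strict gap supplied by the difference row. A HIGH-spin GROUND
state of the model (`E(n, n) = E(n + 1, n − 1) = …`, no gap) is never decided this way — inequality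
certificates bracket such degeneracies, they do not prove them.
[cite: HelgakerJorgensenOlsen2000, §2.4.1 eqs. (2.4.2)-(2.4.3), p. 47] -/
theorem DiffLowerRow.spinPlus_mulVec_eq_zero_of_pos_step {F : Model k} (hF : F.IsSymmetric) {a b : ℕ}
    {lo : ℚ} (h : DiffLowerRow F (a + 1) b F a (b + 1) lo) (hlo : 0 < lo)
    {χ : Fock (Orb (Fin k))} (hχ : IsInSector a (b + 1) χ)
    (hHχ : F.hamiltonian *ᵥ χ = ((F.energy a (b + 1) : ℝ) : ℂ) • χ) : spinPlus *ᵥ χ = 0 :=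
  spinPlus_mulVec_eq_zero_of_lt_of_sector (F.hamiltonian_isHermitian hF)
    (molecularHamiltonian_commute_spinPlus _ _ _) hχ hHχ (h.energy_lt_of_pos hlo)

end Summit.Ventures.CertifiedQuantumChemistry

end
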